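import Literature.Probability.RandomPlanarGeometry.LoewnerBoundaryExtension
import Literature.Probability.RandomPlanarGeometry.LoewnerHullCocycle
import Literature.Probability.RandomPlanarGeometry.LoewnerInverseCocycle
import Literature.Probability.RandomPlanarGeometry.SLETransienceZeroOne
import Literature.Probability.RandomPlanarGeometry.LoewnerSemigroup
import Literature.Probability.RandomPlanarGeometry.LoewnerAccessesAtHit
import Literature.Probability.RandomPlanarGeometry.LoewnerRealKoebe
import HarnessLib

/-!
# The increment chain of a chain generated by a simple curve

Trunk T-STOCH. Deterministic "domain Markov property" in the simple phase: if the chordal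
Loewner chain of the continuous `W` is generated by a simple curve `γ` (`IsSimpleTrace`:
injective, in `ℍ` for positive times), then for every `s > 0` the chain of the increments
`V = W(s + ·)` is generated by the simple curve `β(u) = gₛ(γ(s + u))` (`u > 0`), `β(0) = W s`
(`Loewner.IsGeneratedByCurve.incr`, **proved**; also for the recentred driver `W(s + ·) - W(s)`,
`Loewner.IsGeneratedByCurve.incr_sub`), the boundary extensions compose,
`f̄_{s+u} = f̄ₛ ∘ f̄^V_u` on the closed half-plane (`Loewner.IsGeneratedByCurve.bdryInv_add`), and
consequently the real boundary points `v` at time `t = s + u` split into two kinds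
(`Loewner.IsGeneratedByCurve.bdryInv_add_dichotomy`): those with `f̄ₜ(v) ∈ γ[s, t]` (the "shadow"
of the increment hull), and those of the form `v = g^V_u(x)` for a real `x ≠ W s`, for which
`f̄ₜ(v) = f̄ₛ(x) ∉ γ[s, t]`. The shadow (`Loewner.incrShadow`) is an order-connected set containing
`W t`, of width `O(osc_{[s,t]} W + √u)` (`Loewner.ordConnected_incrShadow`,
`Loewner.abs_sub_le_of_mem_incrShadow`), and an interval off the shadow is the monotone,
non-contracting image of an interval of accesses at time `s`
(`Loewner.exists_interval_of_forall_notMem_incrShadow`). This is the deterministic input of the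
"two accesses at the base of a simple slit" theorem
(`LoewnerSlitAccesses`) used in the `κ = 4` case of Rohde–Schramm's transience theorem
(Thm. 7.1, p. 911: "a.s. there are two limit points `x₀, x₁` for `g₁(z)` as `z → 0` in `H₁`").

## References

* G. F. Lawler, *Conformally Invariant Processes in the Plane*, AMS (2005), §4.1, Rem. 4.9
  (cocycle), §4.4 (simple curves), §6.2 (the curves `γˢ`).
* S. Rohde, O. Schramm, *Basic properties of SLE*, Ann. of Math. 161 (2005), Prop. 2.1, §7.
-/

noncomputable section

open Set Filter Topology Metric Complex Function
open UpperHalfPlane (upperHalfPlaneSet isOpen_upperHalfPlaneSet)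
open scoped NNReal ComplexConjugate

namespace Literature.Probability.RandomPlanarGeometry

namespace Loewner

variable {W : ℝ≥0 → ℝ} {γ : ℝ≥0 → ℂ}

/-! ### Hulls filled in by a simple arc from the real line -/

/-- For a simple arc `β[0, u]` with `β 0 ∈ ℝ` and `β(r) ∈ ℍ` for `r > 0`, the set filled in by
`β[0, u]` (complement in `ℍ` of the unbounded component of `ℍ ∖ β[0, u]`) is `β(0, u]`: the open
set `ℍ ∖ β[0, u]` is connected (`isConnected_upperHalfPlaneSet_diff_image`) and unbounded (the same
computation as `IsGeneratedByCurve.hull_eq_image`). [cite: Lawler2005, §4.4] -/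
theorem sdiff_unboundedComponent_eq_image_of_simple {β : ℝ≥0 → ℂ} (hc : Continuous β)
    (hinj : Injective β) (h0 : (β 0).im = 0) (hpos : ∀ r, 0 < r → 0 < (β r).im) (u : ℝ≥0) :
    upperHalfPlaneSet \ unboundedComponent (upperHalfPlaneSet \ β '' Icc 0 u) = β '' Ioc 0 u := by
  have hconn := Literature.Topology.PlaneTopology.isConnected_upperHalfPlaneSet_diff_image
    hc hinj h0 hpos u
  have hunb : ¬ Bornology.IsBounded (upperHalfPlaneSet \ β '' Icc 0 u) := by
    intro hb
    obtain ⟨R, hR⟩ := (hb.union (isCompact_Icc.image hc).isBounded).subset_closedBall 0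
    have hz : ((|R| + 1 : ℝ) : ℂ) * I ∈ upperHalfPlaneSet \ β '' Icc 0 u ∪ β '' Icc 0 u := by
      by_cases h : ((|R| + 1 : ℝ) : ℂ) * I ∈ β '' Icc 0 u
      · exact Or.inr h
      · refine Or.inl ⟨?_, h⟩
        show 0 < (((|R| + 1 : ℝ) : ℂ) * I).im
        simp only [mul_im, ofReal_re, I_im, mul_one, ofReal_im, I_re, mul_zero, add_zero]
        positivity
    have := hR hz
    rw [mem_closedBall, dist_zero_right, norm_mul, norm_real, norm_I, mul_one,
      Real.norm_eq_abs, abs_of_pos (by positivity)] at this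
    linarith [le_abs_self R]
  rw [unboundedComponent_eq_self hconn.isPreconnected hunb, sdiff_sdiff_right_self]
  ext z
  simp only [Set.mem_inter_iff, mem_image, mem_Icc, mem_Ioc]
  constructor
  · rintro ⟨hz, r, ⟨-, hru⟩, rfl⟩
    refine ⟨r, ⟨?_, hru⟩, rfl⟩
    rcases (show (0 : ℝ≥0) ≤ r from bot_le).eq_or_lt with h | h
    · exfalso
      have : (0 : ℝ) < (β r).im := hz
      rw [← h, h0] at this
      exact lt_irrefl _ this
    · exact h
  · rintro ⟨r, ⟨hr0, hru⟩, rfl⟩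
    exact ⟨hpos r hr0, r, ⟨hr0.le, hru⟩, rfl⟩

/-- A simple arc from the real line generates the chain whose hulls are `β(0, u]`. [folklore] -/
theorem isGeneratedByCurve_of_simple {V : ℝ≥0 → ℝ} {β : ℝ≥0 → ℂ} (hc : Continuous β)
    (hinj : Injective β) (hβ0 : β 0 = V 0) (hpos : ∀ r, 0 < r → 0 < (β r).im)
    (hhull : ∀ u, hull V u = β '' Ioc 0 u) : IsGeneratedByCurve V β := by
  have h0 : (β 0).im = 0 := by rw [hβ0, ofReal_im]
  refine ⟨hc, hβ0, fun r ↦ ?_, fun u ↦ ?_⟩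
  · rcases (show (0 : ℝ≥0) ≤ r from bot_le).eq_or_lt with h | h
    · rw [← h, h0]
    · exact (hpos r h).le
  · rw [hhull u, sdiff_unboundedComponent_eq_image_of_simple hc hinj h0 hpos u]

/-! ### The increment curve -/

open Classical in
/-- The **increment curve** at time `s`: `β(u) = gₛ(γ(s + u))` for `u > 0`, `β(0) = W s`.
[cite: Lawler2005, §6.2] -/
def incrCurve (W : ℝ≥0 → ℝ) (γ : ℝ≥0 → ℂ) (s : ℝ≥0) : ℝ≥0 → ℂ :=
  fun u ↦ if u = 0 then ((W s : ℝ) : ℂ) else map W s (γ (s + u))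

/-- `β 0 = W s`. [folklore] -/
@[simp] theorem incrCurve_zero (W : ℝ≥0 → ℝ) (γ : ℝ≥0 → ℂ) (s : ℝ≥0) :
    incrCurve W γ s 0 = ((W s : ℝ) : ℂ) := by
  simp [incrCurve]

/-- `β u = gₛ(γ(s + u))` for `u > 0`. [folklore] -/
theorem incrCurve_of_pos (W : ℝ≥0 → ℝ) (γ : ℝ≥0 → ℂ) (s : ℝ≥0) {u : ℝ≥0} (hu : 0 < u) :
    incrCurve W γ s u = map W s (γ (s + u)) := by
  simp [incrCurve, hu.ne']

/-- Boundary extensions of translated chains: `f̄^{U + a}_u(v + a) = f̄^U_u(v) + a` (for a chain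
generated by a curve). [folklore] -/
theorem bdryInv_add_const {U : ℝ≥0 → ℝ} {β : ℝ≥0 → ℂ} (hU : Continuous U)
    (hβ : IsGeneratedByCurve U β) (a : ℝ) (u : ℝ≥0) {v : ℂ} (hv : 0 ≤ v.im) :
    bdryInv (fun r ↦ U r + a) u (v + a) = bdryInv U u v + a := by
  have hcl : ∀ {w : ℂ}, 0 ≤ w.im → w ∈ closure upperHalfPlaneSet := fun {w} hw ↦ by
    rw [show closure upperHalfPlaneSet = {z : ℂ | 0 ≤ z.im} from closure_setOf_lt_im 0]
    exact hw
  have hva : 0 ≤ (v + a).im := by simpa using hv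
  haveI : (𝓝[upperHalfPlaneSet] (v + (a : ℂ))).NeBot := mem_closure_iff_nhdsWithin_neBot.1 (hcl hva)
  refine extendFrom_eq (hcl hva) ?_
  -- `f^{U+a}_u(w) = f^U_u(w - a) + a → f̄^U_u(v) + a`
  have hshift : Tendsto (fun w : ℂ ↦ w - a) (𝓝[upperHalfPlaneSet] (v + (a : ℂ)))
      (𝓝[upperHalfPlaneSet] v) := by
    refine tendsto_nhdsWithin_iff.2 ⟨?_, eventually_nhdsWithin_of_forall fun w hw ↦ ?_⟩
    · have : Tendsto (fun w : ℂ ↦ w - a) (𝓝 (v + (a : ℂ))) (𝓝 (v + a - a)) :=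
        (continuous_sub_right (a : ℂ)).tendsto _
      rw [add_sub_cancel_right] at this
      exact this.mono_left nhdsWithin_le_nhds
    · show 0 < (w - a).im
      simpa using (show 0 < w.im from hw)
  have hlim := ((hβ.tendsto_bdryInv hU u hv).comp hshift).add_const (a : ℂ)
  refine hlim.congr' (eventually_nhdsWithin_of_forall fun w hw ↦ ?_)
  have hw' : 0 < (w - a).im := by simpa using (show 0 < w.im from hw)
  have := loewnerInv_add_const hU a u hw'
  simp only [Function.comp_apply, sub_add_cancel] at this ⊢
  exact this.symm

section Incr

variable (hγ : IsGeneratedByCurve W γ) (hs : IsSimpleTrace γ) (hW : Continuous W)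
include hγ hs hW

/-- Points `gₛ(γ(s + u))`, `u > 0`, lie in `ℍ`. [folklore] -/
theorem im_incrCurve_pos (s : ℝ≥0) {u : ℝ≥0} (hu : 0 < u) : 0 < (incrCurve W γ s u).im := by
  rw [incrCurve_of_pos W γ s hu]
  exact im_map_pos hW (hγ.apply_mem_domain_of_lt hs (lt_add_of_pos_right s hu))

/-- `gₛ(γ(s + u))` lies in the hull of the increment chain at time `u`. [folklore] -/
theorem incrCurve_mem_hull (s : ℝ≥0) {u : ℝ≥0} (hu : 0 < u) :
    incrCurve W γ s u ∈ hull (fun r ↦ W (s + r)) u := by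
  rw [incrCurve_of_pos W γ s hu]
  have hsu : s < s + u := lt_add_of_pos_right s hu
  have hdom := hγ.apply_mem_domain_of_lt hs hsu
  have hmem : γ (s + u) ∈ hull W (s + u) :=
    hγ.mem_hull_of_mem_image (hs.2 _ (lt_of_le_of_lt bot_le hsu)) ⟨s + u, ⟨bot_le, le_rfl⟩, rfl⟩
  have h := (mem_hull_iff_map_mem_hull hW hdom hsu.le).1 hmem
  rwa [add_tsub_cancel_left] at h

/-- **The increment curve is continuous.** At `u > 0` by continuity of `gₛ` on `Hₛ`; at `u = 0`
because `gₛ(γ(s + u))` lies in the hull of the increment chain at time `u`, which is within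
`osc_{[s, s+u]} W + 4√u` of `W s` (`norm_sub_driving_le_of_mem_hull`). [cite: Lawler2005, §6.2] -/
theorem continuous_incrCurve (s : ℝ≥0) : Continuous (incrCurve W γ s) := by
  set V : ℝ≥0 → ℝ := fun r ↦ W (s + r) with hV
  have hVc : Continuous V := hW.comp (continuous_const.add continuous_id)
  refine continuous_iff_continuousAt.2 fun u ↦ ?_
  rcases (show (0 : ℝ≥0) ≤ u from bot_le).eq_or_lt with h | hu
  · -- continuity at `0`
    subst h
    rw [ContinuousAt, incrCurve_zero, Metric.tendsto_nhds]
    intro ε hε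
    -- oscillation of `V` small on `[0, d]`, and `4 √d` small
    obtain ⟨θ, hθ, hθV⟩ := Metric.continuousAt_iff.1 (hVc.continuousAt (x := 0)) (ε / 3) (by positivity)
    have hd : ∀ᶠ u : ℝ≥0 in 𝓝 0, (u : ℝ) < min θ (ε ^ 2 / 64) := by
      have : Tendsto (fun u : ℝ≥0 ↦ (u : ℝ)) (𝓝 0) (𝓝 0) := by
        simpa using (NNReal.continuous_coe.tendsto (0 : ℝ≥0))
      exact this.eventually (gt_mem_nhds (by positivity))
    filter_upwards [hd] with u hu
    rcases (show (0 : ℝ≥0) ≤ u from bot_le).eq_or_lt with h0 | hu0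
    · subst h0; simpa using hε
    rw [dist_eq_norm]
    have hosc : ∀ r : ℝ≥0, r ≤ u → |V r - V 0| ≤ ε / 3 := by
      intro r hr
      have hdist : dist r 0 < θ := by
        rw [NNReal.dist_eq, NNReal.coe_zero, sub_zero, abs_of_nonneg r.coe_nonneg]
        exact lt_of_le_of_lt (NNReal.coe_le_coe.2 hr) (hu.trans_le (min_le_left _ _))
      have := hθV hdist
      rw [Real.dist_eq] at this
      exact this.le
    have hbound := norm_sub_driving_le_of_mem_hull hVc hosc (incrCurve_mem_hull hγ hs hW s hu0)
    have hsqrt : Real.sqrt u < ε / 8 := by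
      have h1 : (u : ℝ) < ε ^ 2 / 64 := hu.trans_le (min_le_right _ _)
      have h2 : (ε : ℝ) ^ 2 / 64 = (ε / 8) ^ 2 := by ring
      rw [h2] at h1
      calc Real.sqrt u < Real.sqrt ((ε / 8) ^ 2) := Real.sqrt_lt_sqrt u.coe_nonneg h1
        _ = ε / 8 := Real.sqrt_sq (by positivity)
    have hV0 : V 0 = W s := by simp [hV]
    rw [hV0] at hbound
    linarith
  · -- continuity at `u > 0`
    have heq : incrCurve W γ s =ᶠ[𝓝 u] fun r ↦ map W s (γ (s + r)) := by
      filter_upwards [lt_mem_nhds hu] with r hr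
      exact incrCurve_of_pos W γ s hr
    refine (ContinuousAt.congr ?_ heq.symm)
    have hdom := hγ.apply_mem_domain_of_lt hs (lt_add_of_pos_right s hu)
    have hcont : ContinuousAt (map W s) (γ (s + u)) :=
      continuousAt_map hW ((mem_domain_iff W s _).1 hdom).2
    have hγc : Continuous fun r : ℝ≥0 ↦ γ (s + r) :=
      hγ.continuous.comp (continuous_const.add continuous_id)
    exact ContinuousAt.comp (g := map W s) (f := fun r : ℝ≥0 ↦ γ (s + r)) hcont hγc.continuousAt

/-- **The increment curve is injective.** [folklore] -/
theorem injective_incrCurve (s : ℝ≥0) : Injective (incrCurve W γ s) := by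
  intro u₁ u₂ h
  rcases (show (0 : ℝ≥0) ≤ u₁ from bot_le).eq_or_lt with h₁ | h₁ <;>
    rcases (show (0 : ℝ≥0) ≤ u₂ from bot_le).eq_or_lt with h₂ | h₂
  · rw [← h₁, ← h₂]
  · exfalso
    have := im_incrCurve_pos hγ hs hW s h₂
    rw [← h, ← h₁, incrCurve_zero, ofReal_im] at this
    exact lt_irrefl _ this
  · exfalso
    have := im_incrCurve_pos hγ hs hW s h₁
    rw [h, ← h₂, incrCurve_zero, ofReal_im] at this
    exact lt_irrefl _ this
  · rw [incrCurve_of_pos W γ s h₁, incrCurve_of_pos W γ s h₂] at h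
    have h' := injOn_map hW s (hγ.apply_mem_domain_of_lt hs (lt_add_of_pos_right s h₁))
      (hγ.apply_mem_domain_of_lt hs (lt_add_of_pos_right s h₂)) h
    exact add_left_cancel (hs.1 h')

/-- **The hulls of the increment chain are the increment curve**: `K^V_u = β(0, u]`,
`V = W(s + ·)` (hull cocycle `mem_hull_iff_map_mem_hull` and `K_t = γ(0, t]`).
[cite: Lawler2005, Rem. 4.9] -/
theorem hull_shift_eq_image_incrCurve (s u : ℝ≥0) :
    hull (fun r ↦ W (s + r)) u = incrCurve W γ s '' Ioc 0 u := by
  ext w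
  constructor
  · intro hw
    have hwH : 0 < w.im := hw.1
    set z := loewnerInv W s w with hz
    have hzdom : z ∈ domain W s := loewnerInv_mem_domain hW s hwH
    have hmap : map W s z = w := map_loewnerInv hW s hwH
    have hzhull : z ∈ hull W (s + u) := by
      refine (mem_hull_iff_map_mem_hull hW hzdom le_self_add).2 ?_
      rwa [hmap, add_tsub_cancel_left]
    rw [hγ.hull_eq_image hs (s + u)] at hzhull
    obtain ⟨r, ⟨hr0, hru⟩, hrz⟩ := hzhull
    have hsr : s < r := by
      by_contra hle
      rw [not_lt] at hle
      have : z ∈ hull W s := by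
        rw [hγ.hull_eq_image hs s]
        exact ⟨r, ⟨hr0, hle⟩, hrz⟩
      exact hzdom.2 this
    refine ⟨r - s, ⟨tsub_pos_of_lt hsr, tsub_le_iff_right.2 (by rwa [add_comm])⟩, ?_⟩
    rw [incrCurve_of_pos W γ s (tsub_pos_of_lt hsr), add_tsub_cancel_of_le hsr.le, hrz, hmap]
  · rintro ⟨r, ⟨hr0, hru⟩, rfl⟩
    exact hull_mono _ hru (incrCurve_mem_hull hγ hs hW s hr0)

/-- **The increment chain is generated by the increment curve** (domain Markov property in the
simple phase): for `V = W(s + ·)`, `IsGeneratedByCurve V β`. [cite: Lawler2005, §6.2] -/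
theorem IsGeneratedByCurve.incr (s : ℝ≥0) :
    IsGeneratedByCurve (fun r ↦ W (s + r)) (incrCurve W γ s) :=
  isGeneratedByCurve_of_simple (continuous_incrCurve hγ hs hW s) (injective_incrCurve hγ hs hW s)
    (by simp) (fun _ hr ↦ im_incrCurve_pos hγ hs hW s hr)
    (hull_shift_eq_image_incrCurve hγ hs hW s)

/-- **The recentred increment chain `W(s + ·) - W(s)` is generated by `β - W s`, a simple trace
from `0`.** [cite: Lawler2005, §6.2] -/
theorem IsGeneratedByCurve.incr_sub (s : ℝ≥0) :
    IsGeneratedByCurve (fun r ↦ W (s + r) - W s) (fun u ↦ incrCurve W γ s u - W s) := by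
  refine isGeneratedByCurve_of_simple ((continuous_incrCurve hγ hs hW s).sub continuous_const)
    (fun u₁ u₂ h ↦ injective_incrCurve hγ hs hW s (sub_left_injective h)) (by simp)
    (fun r hr ↦ by simpa using im_incrCurve_pos hγ hs hW s hr) fun u ↦ ?_
  have h := hull_add_const' (fun r ↦ W (s + r) - W s) (W s) u
  simp only [sub_add_cancel] at h
  rw [hull_shift_eq_image_incrCurve hγ hs hW s u] at h
  -- `h : β(0,u] = (· + W s) '' hull (W(s+·) - W s) u`
  have h' : hull (fun r ↦ W (s + r) - W s) u =
      (fun z : ℂ ↦ z - (W s : ℂ)) '' (incrCurve W γ s '' Ioc 0 u) := by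
    rw [h, image_image]
    simp
  rw [h', image_image]

/-- The recentred increment curve is a simple trace. [folklore] -/
theorem isSimpleTrace_incrCurve_sub (s : ℝ≥0) :
    IsSimpleTrace (fun u ↦ incrCurve W γ s u - W s) :=
  ⟨fun u₁ u₂ h ↦ injective_incrCurve hγ hs hW s (sub_left_injective h),
    fun r hr ↦ by simpa using im_incrCurve_pos hγ hs hW s hr⟩

/-! ### The boundary cocycle -/

/-- **The boundary extensions compose**: `f̄_{s+u}(v) = f̄ₛ(f̄^V_u(v))` on the closed half-plane,
`V = W(s + ·)` (the inverse cocycle `loewnerInv_add` on `ℍ`, passed to the limit using the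
continuity of both extensions, the increment chain being generated by a curve).
[cite: Lawler2005, Rem. 4.9] -/
theorem IsGeneratedByCurve.bdryInv_add (s u : ℝ≥0) {v : ℂ} (hv : 0 ≤ v.im) :
    bdryInv W (s + u) v = bdryInv W s (bdryInv (fun r ↦ W (s + r)) u v) := by
  set V : ℝ≥0 → ℝ := fun r ↦ W (s + r) with hV
  have hVc : Continuous V := hW.comp (continuous_const.add continuous_id)
  have hVgen : IsGeneratedByCurve V (incrCurve W γ s) := hγ.incr hs hW s
  set ζ := bdryInv V u v with hζ
  have hζim : 0 ≤ ζ.im := by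
    have := hVgen.bdryInv_mem_closure hVc u hv
    have hsub : closure (domain V u) ⊆ {z : ℂ | 0 ≤ z.im} := by
      rw [← closure_setOf_lt_im 0]
      exact closure_mono (domain_subset V u)
    exact hsub this
  have hcl : v ∈ closure upperHalfPlaneSet := by
    rw [show closure upperHalfPlaneSet = {z : ℂ | 0 ≤ z.im} from closure_setOf_lt_im 0]
    exact hv
  haveI : (𝓝[upperHalfPlaneSet] v).NeBot := mem_closure_iff_nhdsWithin_neBot.1 hcl
  -- both sides are limits of `f_{s+u}(w) = fₛ(f^V_u(w))` as `w → v` in `ℍ`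
  have h1 : Tendsto (loewnerInv W (s + u)) (𝓝[upperHalfPlaneSet] v) (𝓝 (bdryInv W (s + u) v)) :=
    hγ.tendsto_bdryInv hW (s + u) hv
  have h2 : Tendsto (fun w ↦ loewnerInv W s (loewnerInv V u w)) (𝓝[upperHalfPlaneSet] v)
      (𝓝 (bdryInv W s ζ)) := by
    have hin : Tendsto (loewnerInv V u) (𝓝[upperHalfPlaneSet] v) (𝓝[upperHalfPlaneSet] ζ) :=
      tendsto_nhdsWithin_iff.2 ⟨hVgen.tendsto_bdryInv hVc u hv, eventually_nhdsWithin_of_forall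
        fun w hw ↦ im_loewnerInv_pos hVc u hw⟩
    exact (hγ.tendsto_bdryInv hW s hζim).comp hin
  have heq : (fun w ↦ loewnerInv W s (loewnerInv V u w)) =ᶠ[𝓝[upperHalfPlaneSet] v]
      loewnerInv W (s + u) :=
    eventually_nhdsWithin_of_forall fun w hw ↦ (loewnerInv_add hW s u hw).symm
  exact tendsto_nhds_unique h1 (h2.congr' heq)

/-! ### Real boundary points at time `s + u`: the shadow of the increment hull -/

/-- Recentring the boundary extension of the increment chain:
`f̄^{W(s+·)}_u(v) = f̄^{W(s+·)-W(s)}_u(v - W s) + W s`. [folklore] -/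
theorem IsGeneratedByCurve.bdryInv_shift_eq (s u : ℝ≥0) {v : ℂ} (hv : 0 ≤ v.im) :
    bdryInv (fun r ↦ W (s + r)) u v =
      bdryInv (fun r ↦ W (s + r) - W s) u (v - W s) + W s := by
  have hV'c : Continuous fun r ↦ W (s + r) - W s :=
    (hW.comp (continuous_const.add continuous_id)).sub continuous_const
  have h := bdryInv_add_const hV'c (hγ.incr_sub hs hW s) (W s) u (v := v - W s) (by simpa using hv)
  simp only [sub_add_cancel] at h
  exact h

/-- **Dichotomy for real boundary points at time `t = s + u`**: for real `v`, either
`f̄ₜ(v) ∈ γ[s, t]` (the "shadow" of the increment hull), or `v - W s = g^{V'}_u(x)` for a real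
`x ≠ 0` with `f̄ₜ(v) = f̄ₛ(x + W s)`, where `V' = W(s + ·) - W(s)` is the recentred increment
driver: the dichotomy `bdryInv_ofReal_dichotomy` for the recentred increment chain (generated by
a simple curve from `0`, `IsGeneratedByCurve.incr_sub`), transported by the boundary cocycle.
[cite: Lawler2005, §6.2] -/
theorem IsGeneratedByCurve.bdryInv_add_dichotomy (s u : ℝ≥0) (v : ℝ) :
    bdryInv W (s + u) v ∈ γ '' Icc s (s + u) ∨
      ∃ x : ℝ, x ≠ 0 ∧ (map (fun r ↦ W (s + r) - W s) u x).re + W s = v ∧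
        bdryInv W (s + u) v = bdryInv W s ((x + W s : ℝ) : ℂ) := by
  set V' : ℝ≥0 → ℝ := fun r ↦ W (s + r) - W s with hV'
  set β' : ℝ≥0 → ℂ := fun r ↦ incrCurve W γ s r - W s with hβ'
  have hV'c : Continuous V' := (hW.comp (continuous_const.add continuous_id)).sub continuous_const
  have hV'0 : V' 0 = 0 := by simp [hV']
  have hgen' : IsGeneratedByCurve V' β' := hγ.incr_sub hs hW s
  have hs' : IsSimpleTrace β' := isSimpleTrace_incrCurve_sub hγ hs hW s
  -- the cocycle at the real point `v`, through the recentred chain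
  have hcoc := hγ.bdryInv_add hs hW s u (v := (v : ℂ)) (by simp)
  have hrec := hγ.bdryInv_shift_eq hs hW s u (v := (v : ℂ)) (by simp)
  have hcast : ((v : ℂ) - (W s : ℂ)) = ((v - W s : ℝ) : ℂ) := by push_cast; ring
  rw [hcast] at hrec
  rcases bdryInv_ofReal_dichotomy hV'c hV'0 hgen' hs' u (v - W s) with hA | ⟨x', hx', hmap, hval⟩
  · -- (A): `f̄^{V'}_u(v - W s) ∈ β'[0, u]`, so `f̄ₜ(v) ∈ f̄ₛ(β[0, u]) = γ[s, t]`
    left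
    obtain ⟨r, hr, hrβ⟩ := hA
    rw [hcoc, hrec, ← hrβ]
    simp only [hβ', sub_add_cancel]
    rcases (show (0 : ℝ≥0) ≤ r from bot_le).eq_or_lt with h0 | hr0
    · rw [← h0, incrCurve_zero, hγ.bdryInv_driving hW s]
      exact ⟨s, ⟨le_rfl, le_self_add⟩, rfl⟩
    · rw [incrCurve_of_pos W γ s hr0,
        bdryInv_map hW s (hγ.apply_mem_domain_of_lt hs (lt_add_of_pos_right s hr0))]
      exact ⟨s + r, ⟨le_self_add, by gcongr; exact hr.2⟩, rfl⟩
  · -- (B): `v - W s = g^{V'}_u(x')`, `x' ≠ 0`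
    right
    refine ⟨x', hx', ?_, ?_⟩
    · have := congrArg Complex.re hmap
      simp only [ofReal_re] at this
      linarith
    · rw [hcoc, hrec, hval]
      push_cast
      ring_nf

/-- **Old boundary points keep their accesses through the real flow**: for real `x ≠ 0`,
`f̄_{s+u}(g^{V'}_u(x) + W s) = f̄ₛ(x + W s)` (`V' = W(s + ·) - W(s)`). [cite: Lawler2005, §6.2] -/
theorem IsGeneratedByCurve.bdryInv_add_map_ofReal (s u : ℝ≥0) {x : ℝ} (hx : x ≠ 0) :
    bdryInv W (s + u) (((map (fun r ↦ W (s + r) - W s) u x).re + W s : ℝ) : ℂ) =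
      bdryInv W s ((x + W s : ℝ) : ℂ) := by
  set V' : ℝ≥0 → ℝ := fun r ↦ W (s + r) - W s with hV'
  have hV'c : Continuous V' := (hW.comp (continuous_const.add continuous_id)).sub continuous_const
  have hV'0 : V' 0 = 0 := by simp [hV']
  have hgen' := hγ.incr_sub hs hW s
  have hs' := isSimpleTrace_incrCurve_sub hγ hs hW s
  set v : ℝ := (map V' u x).re + W s with hv
  have hcoc := hγ.bdryInv_add hs hW s u (v := (v : ℂ)) (by simp)
  have hrec := hγ.bdryInv_shift_eq hs hW s u (v := (v : ℂ)) (by simp)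
  rw [hcoc, hrec]
  have hreal := map_ofReal_eq_of_isSimpleTrace hV'c hV'0 hgen' hs' hx u
  have h1 : ((v : ℂ) - (W s : ℂ)) = map V' u x := by
    rw [hreal, hv]; push_cast; ring
  rw [h1, bdryInv_map_ofReal hV'c hV'0 hgen' hs' hx u]
  push_cast
  ring_nf

/-- **Accesses at time `s` of points off `γ[s, t]`**: for `s > 0`, `W 0 = 0` and real
`x ≠ W s`, `f̄ₛ(x) ∉ γ[s, s + u]` — it lies on `γ[0, s] ∪ ℝ` (dichotomy at time `s`), meets
`γ[s, ∞)` at most in the tip `γ(s)`, whose only access is `W s`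
(`eq_driving_of_bdryInv_eq`). [cite: Lawler2005, §6.2] -/
theorem IsGeneratedByCurve.bdryInv_ofReal_notMem_image_Icc (hW0 : W 0 = 0) {s : ℝ≥0} (hs0 : 0 < s)
    (u : ℝ≥0) {x : ℝ} (hx : x ≠ W s) : bdryInv W s x ∉ γ '' Icc s (s + u) := by
  rintro ⟨r, hr, hrx⟩
  rcases bdryInv_ofReal_dichotomy hW hW0 hγ hs s x with ⟨r', hr', hr'x⟩ | ⟨x', hx', -, hval⟩
  · -- on `γ[0, s]`: then `γ r = γ r'`, `r = r' = s`, the tip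
    have hrr' : r = r' := hs.1 (hrx.trans hr'x.symm)
    have hrs : r = s := le_antisymm (hrr' ▸ hr'.2) hr.1
    rw [hrs] at hrx
    exact hx (hγ.eq_driving_of_bdryInv_eq hW hs hs0 hrx.symm)
  · -- a nonzero real value: not on `γ[s, t] ⊆ ℍ`
    have him : (γ r).im = 0 := by rw [hrx, hval, ofReal_im]
    have hr0 : 0 < r := lt_of_lt_of_le hs0 hr.1
    exact (hs.2 r hr0).ne' him

/-- **The shadow of the increment hull.** The set of real `v` with `f̄_{s+u}(v) ∈ γ[s, s + u]`.
[cite: RohdeSchramm2005, §7 (proof of Thm 7.1, p. 911)] -/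
def incrShadow (W : ℝ≥0 → ℝ) (γ : ℝ≥0 → ℂ) (s u : ℝ≥0) : Set ℝ :=
  {v : ℝ | bdryInv W (s + u) v ∈ γ '' Icc s (s + u)}

omit hs in
/-- The driving value `W(s + u)` is in the shadow (`f̄ₜ(Wₜ) = γ(t)`). [folklore] -/
theorem driving_mem_incrShadow (s u : ℝ≥0) : W (s + u) ∈ incrShadow W γ s u := by
  show bdryInv W (s + u) (W (s + u)) ∈ γ '' Icc s (s + u)
  rw [hγ.bdryInv_driving hW]
  exact ⟨s + u, ⟨le_self_add, le_rfl⟩, rfl⟩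

/-- Images of real points under the increment flow are off the shadow (`s > 0`, `W 0 = 0`).
[cite: Lawler2005, §6.2] -/
theorem map_notMem_incrShadow (hW0 : W 0 = 0) {s : ℝ≥0} (hs0 : 0 < s) (u : ℝ≥0) {x : ℝ}
    (hx : x ≠ 0) : (map (fun r ↦ W (s + r) - W s) u x).re + W s ∉ incrShadow W γ s u := by
  intro h
  simp only [incrShadow, mem_setOf_eq] at h
  rw [hγ.bdryInv_add_map_ofReal hs hW s u hx] at h
  exact hγ.bdryInv_ofReal_notMem_image_Icc hs hW hW0 hs0 u (x := x + W s)
    (fun h' ↦ hx (by linarith)) (by exact_mod_cast h)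

/-- Off the shadow, a real point is the image of a real `x + W s`, `x ≠ 0`, under the
increment flow, with the same boundary value as `x + W s` at time `s`. [cite: Lawler2005, §6.2] -/
theorem exists_of_notMem_incrShadow (s u : ℝ≥0) {v : ℝ} (hv : v ∉ incrShadow W γ s u) :
    ∃ x : ℝ, x ≠ 0 ∧ (map (fun r ↦ W (s + r) - W s) u x).re + W s = v ∧
      bdryInv W (s + u) v = bdryInv W s ((x + W s : ℝ) : ℂ) :=
  (hγ.bdryInv_add_dichotomy hs hW s u v).resolve_left hv

end Incr

/-! ### The real flow of a chain generated by a simple curve from `0` -/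

section RealMap

variable {U : ℝ≥0 → ℝ} {β : ℝ≥0 → ℂ}
variable (hU : Continuous U) (hU0 : U 0 = 0) (hβ : IsGeneratedByCurve U β) (hsβ : IsSimpleTrace β)
include hU hU0 hβ hsβ

/-- The real flow `x ↦ re gₜ(x)` is continuous on `(0, ∞)` and on `(-∞, 0)`. [folklore] -/
theorem continuousAt_map_ofReal_re {x : ℝ} (hx : x ≠ 0) (t : ℝ≥0) :
    ContinuousAt (fun y : ℝ ↦ (map U t y).re) x :=
  (continuous_re.continuousAt.comp (continuousAt_map_ofReal_of_isSimpleTrace hU hU0 hβ hsβ hx t)).comp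
    continuous_ofReal.continuousAt

/-- `x ≤ re gₜ(x)` for `x > 0`. [folklore] -/
theorem self_le_map_ofReal_re_of_pos {x : ℝ} (hx : 0 < x) (t : ℝ≥0) : x ≤ (map U t x).re :=
  self_le_map_ofReal_re hU (by rwa [hU0])
    (lt_swallowingTime_ofReal_of_isSimpleTrace hU hU0 hβ hsβ hx.ne' t)

/-- **Intermediate values on the right**: every real `v ≥ re gₜ(x)`, `x > 0`, is `re gₜ(y)`
for some `y ≥ x`. [folklore] -/
theorem exists_map_ofReal_re_eq_of_le {x : ℝ} (hx : 0 < x) (t : ℝ≥0) {v : ℝ}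
    (hv : (map U t x).re ≤ v) : ∃ y : ℝ, x ≤ y ∧ (map U t y).re = v := by
  set Y : ℝ := max x v with hY
  have hxY : x ≤ Y := le_max_left _ _
  have hcont : ContinuousOn (fun y : ℝ ↦ (map U t y).re) (Icc x Y) := fun y hy ↦
    (continuousAt_map_ofReal_re hU hU0 hβ hsβ (hx.trans_le hy.1).ne' t).continuousWithinAt
  have hvY : v ≤ (map U t Y).re :=
    (le_max_right x v).trans (self_le_map_ofReal_re_of_pos hU hU0 hβ hsβ (hx.trans_le hxY) t)
  obtain ⟨y, hy, hyv⟩ := intermediate_value_Icc hxY hcont ⟨hv, hvY⟩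
  exact ⟨y, hy.1, hyv⟩

/-- **Gap contraction on the right**: `re gₜ(x₂) - re gₜ(x₁) ≤ x₂ - x₁` for `0 < x₁ ≤ x₂`.
[folklore] -/
theorem map_re_sub_map_re_le_of_pos {x₁ x₂ : ℝ} (hx₁ : 0 < x₁) (h : x₁ ≤ x₂) (t : ℝ≥0) :
    (map U t x₂).re - (map U t x₁).re ≤ x₂ - x₁ :=
  map_re_sub_map_re_le hU (by rwa [hU0]) h
    (lt_swallowingTime_ofReal_of_isSimpleTrace hU hU0 hβ hsβ hx₁.ne' t)

/-- **Displacement bound for the real flow**: if `|U| ≤ S` on `[0, t]` then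
`|re gₜ(x) - x| ≤ 2S + 13√t` for real `x ≠ 0` (the uniform bound
`norm_map_sub_self_le_of_mem_domain` on `Hₜ`, passed to the real point by continuity).
[cite: Lawler2005, Ch. 4 §4.1 (Lemma 4.13)] -/
theorem abs_map_ofReal_re_sub_self_le {t : ℝ≥0} {S : ℝ}
    (hS : ∀ r ∈ Icc (0 : ℝ) t, |U r.toNNReal| ≤ S) {x : ℝ} (hx : x ≠ 0) :
    |(map U t x).re - x| ≤ 2 * S + 13 * Real.sqrt t := by
  have hM : ∀ r ∈ Icc (0 : ℝ) t, ‖(U r.toNNReal : ℂ) - 0‖ ≤ S := fun r hr ↦ by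
    rw [sub_zero, norm_real, Real.norm_eq_abs]; exact hS r hr
  -- along `z → x` in `ℍ`, `‖gₜ z - z‖ ≤ 2S + 13√t`
  have hcont : ContinuousAt (map U t) x := continuousAt_map_ofReal_of_isSimpleTrace hU hU0 hβ hsβ hx t
  have hev := eventually_mem_domain_ofReal_of_isSimpleTrace hU0 hβ hsβ hx t
  haveI := neBot_nhdsWithin_ofReal x
  have hlim : Tendsto (fun z ↦ ‖map U t z - z‖) (𝓝[upperHalfPlaneSet] (x : ℂ))
      (𝓝 ‖map U t x - x‖) :=
    ((hcont.tendsto.sub (continuous_id.tendsto _)).norm).mono_left nhdsWithin_le_nhds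
  have hbound : ∀ᶠ z in 𝓝[upperHalfPlaneSet] (x : ℂ), ‖map U t z - z‖ ≤ 2 * S + 13 * Real.sqrt t := by
    filter_upwards [nhdsWithin_le_nhds hev, self_mem_nhdsWithin] with z hz hzH
    exact norm_map_sub_self_le_of_mem_domain hU hM (hz hzH)
  have h := le_of_tendsto hlim hbound
  have hre : |(map U t x).re - x| ≤ ‖map U t x - x‖ := by
    simpa using abs_re_le_norm (map U t x - x)
  exact hre.trans h

/-- Reflection of the real flow: `re g^{-U}_t(-x) = - re g^U_t(x)` for real `x ≠ 0`.
[folklore] -/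
theorem map_neg_ofReal_re {x : ℝ} (hx : x ≠ 0) (t : ℝ≥0) :
    (map (fun r ↦ -U r) t (((-x : ℝ) : ℂ))).re = -(map U t x).re := by
  have hT := lt_swallowingTime_ofReal_of_isSimpleTrace hU hU0 hβ hsβ hx t
  have h := realFlow_neg_driving hU hT
  simp only [realFlow] at h
  linarith

/-- `re gₜ(x) ≤ x` for `x < 0`. [folklore] -/
theorem map_ofReal_re_le_self_of_neg {x : ℝ} (hx : x < 0) (t : ℝ≥0) : (map U t x).re ≤ x := by
  have hT : (t : WithTop ℝ≥0) < swallowingTime (fun r ↦ -U r) (((-x : ℝ) : ℂ)) := by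
    rw [swallowingTime_neg_ofReal]
    exact lt_swallowingTime_ofReal_of_isSimpleTrace hU hU0 hβ hsβ hx.ne t
  have h := self_le_map_ofReal_re (W := fun r ↦ -U r) hU.neg (x := -x) (by simp [hU0]; linarith) hT
  rw [map_neg_ofReal_re hU hU0 hβ hsβ hx.ne t] at h
  linarith

/-- **Intermediate values on the left**: every real `v ≤ re gₜ(x)`, `x < 0`, is `re gₜ(y)` for
some `y ≤ x`. [folklore] -/
theorem exists_map_ofReal_re_eq_of_le_of_neg {x : ℝ} (hx : x < 0) (t : ℝ≥0) {v : ℝ}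
    (hv : v ≤ (map U t x).re) : ∃ y : ℝ, y ≤ x ∧ (map U t y).re = v := by
  set Y : ℝ := min x v with hY
  have hYx : Y ≤ x := min_le_left _ _
  have hY0 : Y < 0 := lt_of_le_of_lt hYx hx
  have hcont : ContinuousOn (fun y : ℝ ↦ (map U t y).re) (Icc Y x) := fun y hy ↦
    (continuousAt_map_ofReal_re hU hU0 hβ hsβ (lt_of_le_of_lt hy.2 hx).ne t).continuousWithinAt
  have hvY : (map U t Y).re ≤ v :=
    (map_ofReal_re_le_self_of_neg hU hU0 hβ hsβ hY0 t).trans (min_le_right x v)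
  obtain ⟨y, hy, hyv⟩ := intermediate_value_Icc hYx hcont ⟨hvY, hv⟩
  exact ⟨y, hy.2, hyv⟩

/-- **Gap contraction on the left**: `re gₜ(x₂) - re gₜ(x₁) ≤ x₂ - x₁` for `x₁ ≤ x₂ < 0`
(reflection of `map_re_sub_map_re_le`). [folklore] -/
theorem map_re_sub_map_re_le_of_neg {x₁ x₂ : ℝ} (h : x₁ ≤ x₂) (hx₂ : x₂ < 0) (t : ℝ≥0) :
    (map U t x₂).re - (map U t x₁).re ≤ x₂ - x₁ := by
  have hx₁ : x₁ < 0 := lt_of_le_of_lt h hx₂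
  have hT : (t : WithTop ℝ≥0) < swallowingTime (fun r ↦ -U r) (((-x₂ : ℝ) : ℂ)) := by
    rw [swallowingTime_neg_ofReal]
    exact lt_swallowingTime_ofReal_of_isSimpleTrace hU hU0 hβ hsβ hx₂.ne t
  have hgap := map_re_sub_map_re_le (W := fun r ↦ -U r) hU.neg (p := -x₂) (x := -x₁)
    (by simp [hU0]; linarith) (by linarith) hT
  rw [map_neg_ofReal_re hU hU0 hβ hsβ hx₁.ne t, map_neg_ofReal_re hU hU0 hβ hsβ hx₂.ne t] at hgap
  linarith

end RealMap

/-! ### Structure of the shadow -/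

section Shadow

variable (hγ : IsGeneratedByCurve W γ) (hs : IsSimpleTrace γ) (hW : Continuous W) (hW0 : W 0 = 0)
include hγ hs hW hW0

/-- **Points of the shadow lie left of the images of positive points** (`s > 0`): if
`v ∈ shadow` and `x > 0` then `v < re g^{V'}_u(x) + W s`; for otherwise `v`, lying above the image
of `x`, would itself be an image (intermediate values). [cite: Lawler2005, §6.2] -/
theorem lt_map_of_mem_incrShadow {s : ℝ≥0} (hs0 : 0 < s) (u : ℝ≥0) {v : ℝ}
    (hv : v ∈ incrShadow W γ s u) {x : ℝ} (hx : 0 < x) :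
    v < (map (fun r ↦ W (s + r) - W s) u x).re + W s := by
  set V' : ℝ≥0 → ℝ := fun r ↦ W (s + r) - W s with hV'
  have hV'c : Continuous V' := (hW.comp (continuous_const.add continuous_id)).sub continuous_const
  have hV'0 : V' 0 = 0 := by simp [hV']
  have hgen' := hγ.incr_sub hs hW s
  have hs' := isSimpleTrace_incrCurve_sub hγ hs hW s
  by_contra hle
  rw [not_lt] at hle
  obtain ⟨y, hxy, hyv⟩ := exists_map_ofReal_re_eq_of_le hV'c hV'0 hgen' hs' hx u
    (v := v - W s) (by linarith)
  have hy0 : y ≠ 0 := (hx.trans_le hxy).ne'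
  have := map_notMem_incrShadow hγ hs hW hW0 hs0 u hy0
  rw [hyv, sub_add_cancel] at this
  exact this hv

/-- **Points of the shadow lie right of the images of negative points.**
[cite: Lawler2005, §6.2] -/
theorem map_lt_of_mem_incrShadow {s : ℝ≥0} (hs0 : 0 < s) (u : ℝ≥0) {v : ℝ}
    (hv : v ∈ incrShadow W γ s u) {x : ℝ} (hx : x < 0) :
    (map (fun r ↦ W (s + r) - W s) u x).re + W s < v := by
  set V' : ℝ≥0 → ℝ := fun r ↦ W (s + r) - W s with hV'
  have hV'c : Continuous V' := (hW.comp (continuous_const.add continuous_id)).sub continuous_const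
  have hV'0 : V' 0 = 0 := by simp [hV']
  have hgen' := hγ.incr_sub hs hW s
  have hs' := isSimpleTrace_incrCurve_sub hγ hs hW s
  by_contra hle
  rw [not_lt] at hle
  obtain ⟨y, hyx, hyv⟩ := exists_map_ofReal_re_eq_of_le_of_neg hV'c hV'0 hgen' hs' hx u
    (v := v - W s) (by linarith)
  have hy0 : y ≠ 0 := (lt_of_le_of_lt hyx hx).ne
  have := map_notMem_incrShadow hγ hs hW hW0 hs0 u hy0
  rw [hyv, sub_add_cancel] at this
  exact this hv

/-- **The shadow is an interval** (order-connected): a point between two shadow points which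
were off the shadow would be the image of a positive or of a negative real point, hence right of
or left of the whole shadow. [cite: RohdeSchramm2005, §7 (proof of Thm 7.1, p. 911)] -/
theorem ordConnected_incrShadow {s : ℝ≥0} (hs0 : 0 < s) (u : ℝ≥0) :
    OrdConnected (incrShadow W γ s u) := by
  refine ⟨fun v₁ hv₁ v₂ hv₂ v hv ↦ ?_⟩
  by_contra hvn
  obtain ⟨x, hx0, hxv, -⟩ := exists_of_notMem_incrShadow hγ hs hW s u hvn
  rcases lt_or_gt_of_ne hx0 with hneg | hpos
  · have := map_lt_of_mem_incrShadow hγ hs hW hW0 hs0 u hv₁ hneg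
    rw [hxv] at this
    exact absurd hv.1 (not_le.2 this)
  · have := lt_map_of_mem_incrShadow hγ hs hW hW0 hs0 u hv₂ hpos
    rw [hxv] at this
    exact absurd hv.2 (not_le.2 this)

/-- **Width of the shadow**: if `|W(s + r) - W(s)| ≤ S` for `r ∈ [0, u]`, every shadow point is
within `2S + 13√u` of `W s` (displacement bound for the real flow of the increment chain and the
two order lemmas). [cite: Lawler2005, Ch. 4 §4.1 (Lemma 4.13)] -/
theorem abs_sub_le_of_mem_incrShadow {s : ℝ≥0} (hs0 : 0 < s) {u : ℝ≥0} {S : ℝ}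
    (hS : ∀ r ∈ Icc (0 : ℝ) u, |W (s + r.toNNReal) - W s| ≤ S) {v : ℝ}
    (hv : v ∈ incrShadow W γ s u) : |v - W s| ≤ 2 * S + 13 * Real.sqrt u := by
  set V' : ℝ≥0 → ℝ := fun r ↦ W (s + r) - W s with hV'
  have hV'c : Continuous V' := (hW.comp (continuous_const.add continuous_id)).sub continuous_const
  have hV'0 : V' 0 = 0 := by simp [hV']
  have hgen' := hγ.incr_sub hs hW s
  have hs' := isSimpleTrace_incrCurve_sub hγ hs hW s
  have hS' : ∀ r ∈ Icc (0 : ℝ) u, |V' r.toNNReal| ≤ S := fun r hr ↦ by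
    simpa [hV'] using hS r hr
  set L : ℝ := 2 * S + 13 * Real.sqrt u with hL
  rw [abs_le]
  constructor
  · -- lower bound: otherwise `v` lies left of the image of a negative point close to `0`
    by_contra hlt
    rw [not_le] at hlt
    set x : ℝ := ((v - W s) + L) / 2 with hx
    have hx0 : x < 0 := by rw [hx]; linarith
    have hdisp := abs_map_ofReal_re_sub_self_le hV'c hV'0 hgen' hs' hS' hx0.ne
    rw [abs_le] at hdisp
    have hlt' := map_lt_of_mem_incrShadow hγ hs hW hW0 hs0 u hv hx0
    simp only [hV'] at hdisp hlt'
    linarith [hdisp.1]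
  · by_contra hlt
    rw [not_le] at hlt
    set x : ℝ := ((v - W s) - L) / 2 with hx
    have hx0 : 0 < x := by rw [hx]; linarith
    have hdisp := abs_map_ofReal_re_sub_self_le hV'c hV'0 hgen' hs' hS' hx0.ne'
    rw [abs_le] at hdisp
    have hlt' := lt_map_of_mem_incrShadow hγ hs hW hW0 hs0 u hv hx0
    simp only [hV'] at hdisp hlt'
    linarith [hdisp.2]

/-- **Transport of an interval off the shadow back to time `s`.** If `[v₁, v₂]` misses the
shadow, then it is the monotone image under the increment flow `x ↦ re g^{V'}_u(x) + W s` of an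
interval `[x₁, x₂]` of nonzero reals of one sign, of length `≥ v₂ - v₁` (gap contraction), all of
whose points `y` keep their boundary values: `f̄ₛ(y + W s) = f̄_{s+u}(re g^{V'}_u(y) + W s)`.
[cite: RohdeSchramm2005, §7 (proof of Thm 7.1, p. 911)] -/
theorem exists_interval_of_forall_notMem_incrShadow {s : ℝ≥0} (hs0 : 0 < s) (u : ℝ≥0)
    {v₁ v₂ : ℝ} (hv : v₁ ≤ v₂) (hoff : ∀ v ∈ Icc v₁ v₂, v ∉ incrShadow W γ s u) :
    ∃ x₁ x₂ : ℝ, x₁ ≤ x₂ ∧ v₂ - v₁ ≤ x₂ - x₁ ∧ (0 < x₁ ∨ x₂ < 0) ∧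
      ∀ y ∈ Icc x₁ x₂, (map (fun r ↦ W (s + r) - W s) u y).re + W s ∈ Icc v₁ v₂ ∧
        bdryInv W s ((y + W s : ℝ) : ℂ) =
          bdryInv W (s + u) ((((map (fun r ↦ W (s + r) - W s) u y).re + W s : ℝ) : ℂ)) := by
  set V' : ℝ≥0 → ℝ := fun r ↦ W (s + r) - W s with hV'
  have hV'c : Continuous V' := (hW.comp (continuous_const.add continuous_id)).sub continuous_const
  have hV'0 : V' 0 = 0 := by simp [hV']
  have hgen' := hγ.incr_sub hs hW s
  have hs' := isSimpleTrace_incrCurve_sub hγ hs hW s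
  obtain ⟨x₁, hx₁0, hx₁v, -⟩ :=
    exists_of_notMem_incrShadow hγ hs hW s u (hoff v₁ (left_mem_Icc.2 hv))
  obtain ⟨x₂, hx₂0, hx₂v, -⟩ :=
    exists_of_notMem_incrShadow hγ hs hW s u (hoff v₂ (right_mem_Icc.2 hv))
  have hWt := driving_mem_incrShadow hγ hW s u
  have hmonoP := map_ofReal_re_strictMonoOn_pos_of_isSimpleTrace hV'c hV'0 hgen' hs' u
  have hmonoN := map_ofReal_re_strictMonoOn_neg_of_isSimpleTrace hV'c hV'0 hgen' hs' u
  have hval : ∀ y : ℝ, y ≠ 0 → bdryInv W s ((y + W s : ℝ) : ℂ) =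
      bdryInv W (s + u) ((((map V' u y).re + W s : ℝ) : ℂ)) :=
    fun y hy ↦ (hγ.bdryInv_add_map_ofReal hs hW s u hy).symm
  -- `W(s + u)` is off `[v₁, v₂]`: the interval lies on one side
  have hside : W (s + u) < v₁ ∨ v₂ < W (s + u) := by
    by_contra h
    push Not at h
    exact hoff _ ⟨h.1, h.2⟩ hWt
  rcases hside with hR | hL
  · -- right of `W(s+u)`: `x₁, x₂ > 0`
    have hpos : ∀ {x v : ℝ}, x ≠ 0 → (map V' u x).re + W s = v → W (s + u) < v → 0 < x := by
      intro x v hx hxv hv'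
      by_contra hle
      have hneg : x < 0 := lt_of_le_of_ne (not_lt.1 hle) hx
      have := map_lt_of_mem_incrShadow hγ hs hW hW0 hs0 u hWt hneg
      simp only [hV'] at hxv
      linarith
    have h₁ : 0 < x₁ := hpos hx₁0 hx₁v hR
    have h₂ : 0 < x₂ := hpos hx₂0 hx₂v (hR.trans_le hv)
    have hx₁₂ : x₁ ≤ x₂ := by
      by_contra hlt
      rw [not_le] at hlt
      have := hmonoP h₂ h₁ hlt
      simp only [hV'] at hx₁v hx₂v this
      linarith
    refine ⟨x₁, x₂, hx₁₂, ?_, Or.inl h₁, fun y hy ↦ ⟨?_, hval y (h₁.trans_le hy.1).ne'⟩⟩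
    · have := map_re_sub_map_re_le_of_pos hV'c hV'0 hgen' hs' h₁ hx₁₂ u
      simp only [hV'] at hx₁v hx₂v this
      linarith
    · have hy0 : 0 < y := h₁.trans_le hy.1
      have hm₁ : (map V' u x₁).re ≤ (map V' u y).re := hmonoP.monotoneOn h₁ hy0 hy.1
      have hm₂ : (map V' u y).re ≤ (map V' u x₂).re := hmonoP.monotoneOn hy0 h₂ hy.2
      simp only [hV'] at hx₁v hx₂v hm₁ hm₂
      constructor <;> linarith
  · -- left of `W(s+u)`: `x₁, x₂ < 0`
    have hneg : ∀ {x v : ℝ}, x ≠ 0 → (map V' u x).re + W s = v → v < W (s + u) → x < 0 := by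
      intro x v hx hxv hv'
      by_contra hle
      have hpos : 0 < x := lt_of_le_of_ne (not_lt.1 hle) (Ne.symm hx)
      have := lt_map_of_mem_incrShadow hγ hs hW hW0 hs0 u hWt hpos
      simp only [hV'] at hxv
      linarith
    have h₁ : x₁ < 0 := hneg hx₁0 hx₁v (lt_of_le_of_lt hv hL)
    have h₂ : x₂ < 0 := hneg hx₂0 hx₂v hL
    have hx₁₂ : x₁ ≤ x₂ := by
      by_contra hlt
      rw [not_le] at hlt
      have := hmonoN h₂ h₁ hlt
      simp only [hV'] at hx₁v hx₂v this
      linarith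
    refine ⟨x₁, x₂, hx₁₂, ?_, Or.inr h₂, fun y hy ↦ ⟨?_, hval y (lt_of_le_of_lt hy.2 h₂).ne⟩⟩
    · have := map_re_sub_map_re_le_of_neg hV'c hV'0 hgen' hs' hx₁₂ h₂ u
      simp only [hV'] at hx₁v hx₂v this
      linarith
    · have hy0 : y < 0 := lt_of_le_of_lt hy.2 h₂
      have hm₁ : (map V' u x₁).re ≤ (map V' u y).re := hmonoN.monotoneOn h₁ hy0 hy.1
      have hm₂ : (map V' u y).re ≤ (map V' u x₂).re := hmonoN.monotoneOn hy0 h₂ hy.2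
      simp only [hV'] at hx₁v hx₂v hm₁ hm₂
      constructor <;> linarith

end Shadow

end Loewner

end Literature.Probability.RandomPlanarGeometry
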